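import Summits.CriticalPhenomena.Ising3DConformalLimit.Theorems.PlantedPinningGaussianPinningSaturationStructure
import Summits.CriticalPhenomena.Ising3DConformalLimit.Theorems.GaussianLimitNotScreened.Negative.ModelBlindSharp
import Summits.CriticalPhenomena.Ising3DConformalLimit.Theorems.PerfectScreeningGaussianLimitIsCoulombCore

/-!
# Line `registered` for crux `GaussianPinningSaturation` (stmt-CriticalPhenomena-8452): the logical position of the crux

Lead seat c2 (`prover-line-stmt-CriticalPhenomena-8452-c2-0`), route `PlantedPinning`, sub-problem
`Ising3DConformalLimit`. Pure logic around the crux r3, kernel-checking the structural remarks of the route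
review (refuter `rreview-d17a2435`), the grounding (`g27-1`) and the two lead seats:

* `gaussianPinningSaturation_iff_imp` — the conclusion of r3 does not mention `(ρ, Δ, S)`, so r3 is the material
  implication "(∃ non-degenerate Möbius pointwise limit of `criticalCorr 3` with `U₄ ≡ 0` off coincidences) →
  (unconditional lattice saturation `e_L(⌈pn⌉) → 1`)".
* `gaussianPinningSaturation_of_moebiusNonGaussian` / `moebiusNonGaussian_of_deficit_of_saturation` /
  `gaussianPinningSaturation_iff_moebiusNonGaussian` — given the route's own crux r2 `PinningEfficiencyDeficit`
  (`e* < 1`), r3 is EQUIVALENT to "every non-degenerate Möbius-covariant (`Δ > 0`) pointwise scaling limit of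
  `criticalCorr 3` has `U₄ ≢ 0`", i.e. to item 0636 `IsingEuclidUpgradeR4NonGaussian` restricted to Möbius limits
  (`moebiusNonGaussian_of_R4NonGaussian`): under r2 the crux carries exactly clause (iii) of the conjunct.
* `not_latticeSaturation_of_deficit` — r2 forbids the lattice conclusion of r3 outright, so under r2 no proof of r3
  can establish its conclusion; it must refute its hypothesis block.
* `modelBlind_iff_latticeSaturation` / `not_modelBlind_of_deficit` — the hypothesis block with `criticalCorr 3`
  replaced by an arbitrary lattice family is CONSISTENT (witness: the sampled generalised free field
  `gffLattice (3/5)` → `gffFamily (3/5)` of `Theorems/GaussianLimitNotScreened/Negative/ModelBlindSharp.lean`), hence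
  the model-blind form of r3 is equivalent to unconditional lattice saturation and is refuted by r2: any proof of
  r3 compatible with the route must use a property of the critical Ising correlators beyond the hypothesis block —
  and, the conclusion being `S`-free, can only do so by proving non-Gaussianity of the Ising limit.

No definitions, no named facts, no `sorry`; statements are spelled out over the landed `plantedEff`
(`gaussianPinningSaturation_iff`, Defs file p143350/p148394).
-/

noncomputable section

namespace Summit.CriticalPhenomena.Ising3DConformalLimit.PlantedPinningGaussianPinningSaturation

open scoped BigOperators Classical
open Finset MeasureTheory
open Literature.Probability.LatticeModels
open Summit.CriticalPhenomena.Ising3DConformalLimit.Theses.PlantedPinning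
open Summit.CriticalPhenomena.Ising3DConformalLimit.Theses.IsingEuclidUpgrade
open Summit.CriticalPhenomena.Ising3DConformalLimit.GaussianLimitNotScreenedNegative

/-! ### r3 is a material implication with an `S`-free conclusion -/

/-- **Shape of the crux.** `GaussianPinningSaturation` is the implication "(∃ (ρ,Δ,S) satisfying the hypothesis
block) → (unconditional saturation of the planted-pinning efficiency on the lattice)": its conclusion does not
mention `(ρ, Δ, S)`. -/
theorem gaussianPinningSaturation_iff_imp :
    GaussianPinningSaturation ↔
      ((∃ (ρ : ℝ → ℝ) (Δ : ℝ) (S : CorrFamily 3), (∀ δ ∈ Set.Ioc (0:ℝ) 1, 0 < ρ δ) ∧ 0 < Δ ∧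
          HasPointwiseScalingLimit (criticalCorr 3) ρ S ∧ IsNondegenerateTwoPoint S ∧
          IsMoebiusCovariant Δ S ∧ ¬ HasNontrivialU4 S) →
        ∀ ε : ℝ, 0 < ε → ∃ p₀ : ℝ, 0 < p₀ ∧ ∀ p : ℝ, 0 < p → p < p₀ → ∃ L₀ : ℕ, ∀ L ≥ L₀,
          1 - ε ≤ plantedEff L ⌈p * ((box 3 L).card : ℝ)⌉₊) := by
  rw [gaussianPinningSaturation_iff]
  constructor
  · rintro h ⟨ρ, Δ, S, hρ, hΔ, hlim, hnd, hmob, hU4⟩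
    exact h ρ Δ S hρ hΔ hlim hnd hmob hU4
  · intro h ρ Δ S hρ hΔ hlim hnd hmob hU4
    exact h ⟨ρ, Δ, S, hρ, hΔ, hlim, hnd, hmob, hU4⟩

/-! ### Under r2 the crux is exactly non-Gaussianity of every Möbius limit -/

/-- Non-Gaussianity of every non-degenerate Möbius-covariant pointwise limit of `criticalCorr 3` (item 0636
restricted to Möbius limits) proves the crux, ex falso. -/
theorem gaussianPinningSaturation_of_moebiusNonGaussian
    (h : ∀ (ρ : ℝ → ℝ) (Δ : ℝ) (S : CorrFamily 3), (∀ δ ∈ Set.Ioc (0:ℝ) 1, 0 < ρ δ) → 0 < Δ →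
      HasPointwiseScalingLimit (criticalCorr 3) ρ S → IsNondegenerateTwoPoint S →
      IsMoebiusCovariant Δ S → HasNontrivialU4 S) :
    GaussianPinningSaturation := by
  rw [gaussianPinningSaturation_iff]
  intro ρ Δ S hρ hΔ hlim hnd hmob hU4
  exact absurd (h ρ Δ S hρ hΔ hlim hnd hmob) hU4

/-- Item 0636 `IsingEuclidUpgradeR4NonGaussian` implies its Möbius-restricted form. -/
theorem moebiusNonGaussian_of_R4NonGaussian (h : IsingEuclidUpgradeR4NonGaussian) :
    ∀ (ρ : ℝ → ℝ) (Δ : ℝ) (S : CorrFamily 3), (∀ δ ∈ Set.Ioc (0:ℝ) 1, 0 < ρ δ) → 0 < Δ →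
      HasPointwiseScalingLimit (criticalCorr 3) ρ S → IsNondegenerateTwoPoint S →
      IsMoebiusCovariant Δ S → HasNontrivialU4 S :=
  fun ρ _ S hρ _ hlim hnd _ => h ρ S hρ hlim hnd

/-- **r2 ∧ r3 ⇒ clause (iii) for Möbius limits.** Given the deficit `e* < 1` (r2), the crux forces every
non-degenerate Möbius-covariant pointwise limit of `criticalCorr 3` to have `U₄ ≢ 0` (the contradiction of the
route's deciding theorem `closes`, isolated). -/
theorem moebiusNonGaussian_of_deficit_of_saturation (hdef : PinningEfficiencyDeficit)
    (hsat : GaussianPinningSaturation) :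
    ∀ (ρ : ℝ → ℝ) (Δ : ℝ) (S : CorrFamily 3), (∀ δ ∈ Set.Ioc (0:ℝ) 1, 0 < ρ δ) → 0 < Δ →
      HasPointwiseScalingLimit (criticalCorr 3) ρ S → IsNondegenerateTwoPoint S →
      IsMoebiusCovariant Δ S → HasNontrivialU4 S := by
  intro ρ Δ S hρ hΔ hlim hnd hmob
  by_contra hU4
  obtain ⟨ε, hε, p₀, hp₀, hd⟩ := hdef
  obtain ⟨p₁, hp₁, hs⟩ := hsat ρ Δ S hρ hΔ hlim hnd hmob hU4 (ε / 2) (by linarith)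
  have hmin : 0 < min p₀ p₁ := lt_min hp₀ hp₁
  have hle₀ : min p₀ p₁ ≤ p₀ := min_le_left p₀ p₁
  have hle₁ : min p₀ p₁ ≤ p₁ := min_le_right p₀ p₁
  obtain ⟨L₀, hL₀⟩ := hd (min p₀ p₁ / 2) (by linarith) (by linarith)
  obtain ⟨L₁, hL₁⟩ := hs (min p₀ p₁ / 2) (by linarith) (by linarith)
  have h₀ := hL₀ (max L₀ L₁) (le_max_left L₀ L₁)
  have h₁ := hL₁ (max L₀ L₁) (le_max_right L₀ L₁)
  linarith

/-- **Under r2, r3 ⟺ non-Gaussianity of every Möbius limit.** Given `PinningEfficiencyDeficit`, the crux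
`GaussianPinningSaturation` is equivalent to "every non-degenerate Möbius-covariant (`Δ > 0`) pointwise scaling
limit of the critical Ising correlators on `ℤ³` has a non-trivial connected four-point function". -/
theorem gaussianPinningSaturation_iff_moebiusNonGaussian (hdef : PinningEfficiencyDeficit) :
    GaussianPinningSaturation ↔
      ∀ (ρ : ℝ → ℝ) (Δ : ℝ) (S : CorrFamily 3), (∀ δ ∈ Set.Ioc (0:ℝ) 1, 0 < ρ δ) → 0 < Δ →
        HasPointwiseScalingLimit (criticalCorr 3) ρ S → IsNondegenerateTwoPoint S →
        IsMoebiusCovariant Δ S → HasNontrivialU4 S :=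
  ⟨moebiusNonGaussian_of_deficit_of_saturation hdef, gaussianPinningSaturation_of_moebiusNonGaussian⟩

/-- Registered bookkeeping stub `stub_cruxIffMoebiusNonGaussian` of the crux item (lead seat c2): under r2 the
crux is equivalent to non-Gaussianity of every Möbius limit, keyed by its registered name
(= `gaussianPinningSaturation_iff_moebiusNonGaussian`). -/
theorem stub_cruxIffMoebiusNonGaussian : PinningEfficiencyDeficit → (GaussianPinningSaturation ↔ ∀ (ρ : ℝ → ℝ) (Δ : ℝ) (S : CorrFamily 3), (∀ δ ∈ Set.Ioc (0:ℝ) 1, 0 < ρ δ) → 0 < Δ → HasPointwiseScalingLimit (criticalCorr 3) ρ S → IsNondegenerateTwoPoint S → IsMoebiusCovariant Δ S → HasNontrivialU4 S) :=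
  gaussianPinningSaturation_iff_moebiusNonGaussian

/-- **r2 forbids the conclusion of r3.** Given the deficit, unconditional lattice saturation is false; so under
r2 any proof of the crux must refute its hypothesis block. -/
theorem not_latticeSaturation_of_deficit (hdef : PinningEfficiencyDeficit) :
    ¬ ∀ ε : ℝ, 0 < ε → ∃ p₀ : ℝ, 0 < p₀ ∧ ∀ p : ℝ, 0 < p → p < p₀ → ∃ L₀ : ℕ, ∀ L ≥ L₀,
        1 - ε ≤ plantedEff L ⌈p * ((box 3 L).card : ℝ)⌉₊ := by
  intro hsat
  obtain ⟨ε, hε, p₀, hp₀, hd⟩ := hdef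
  obtain ⟨p₁, hp₁, hs⟩ := hsat (ε / 2) (by linarith)
  have hmin : 0 < min p₀ p₁ := lt_min hp₀ hp₁
  have hle₀ : min p₀ p₁ ≤ p₀ := min_le_left p₀ p₁
  have hle₁ : min p₀ p₁ ≤ p₁ := min_le_right p₀ p₁
  obtain ⟨L₀, hL₀⟩ := hd (min p₀ p₁ / 2) (by linarith) (by linarith)
  obtain ⟨L₁, hL₁⟩ := hs (min p₀ p₁ / 2) (by linarith) (by linarith)
  have h₀ := hL₀ (max L₀ L₁) (le_max_left L₀ L₁)
  have h₁ := hL₁ (max L₀ L₁) (le_max_right L₀ L₁)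
  have : plantedEff (max L₀ L₁) ⌈min p₀ p₁ / 2 * ((box 3 (max L₀ L₁)).card : ℝ)⌉₊ ≤ 1 - ε := h₀
  linarith

/-! ### The hypothesis block is consistent for lattice families: the model-blind crux is lattice saturation -/

/-- **The hypothesis block of the crux is satisfiable by a lattice family**: the generalised free field of
dimension `3/5` sampled on `ℤ³` has the pointwise scaling limit `gffFamily (3/5)` under `ρ(δ) = δ^{-3/5}`, which is
non-degenerate, Möbius covariant with `Δ = 3/5 > 0` and has `U₄ ≡ 0` (witnesses of
`Theorems/GaussianLimitNotScreened/Negative/ModelBlindSharp.lean`). -/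
theorem hypothesisBlock_satisfiable :
    ∃ (G : LatticeCorrFamily 3) (ρ : ℝ → ℝ) (Δ : ℝ) (S : CorrFamily 3), (∀ δ ∈ Set.Ioc (0:ℝ) 1, 0 < ρ δ) ∧
      0 < Δ ∧ HasPointwiseScalingLimit G ρ S ∧ IsNondegenerateTwoPoint S ∧ IsMoebiusCovariant Δ S ∧
      ¬ HasNontrivialU4 S :=
  ⟨gffLattice (3/5), fun δ => δ ^ (-(3/5:ℝ)), 3/5, gffFamily (3/5),
    fun δ hδ => Real.rpow_pos_of_pos hδ.1 _, by norm_num, gffLattice_hasLimit _,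
    isNondegenerateTwoPoint_gff _, isMoebiusCovariant_gff _, not_hasNontrivialU4_gff _⟩

/-- **Model-blind crux ⟺ unconditional lattice saturation.** Replacing `criticalCorr 3` by an arbitrary lattice
family `G` in the hypothesis block gives a statement equivalent to the bare lattice conclusion (the block is
satisfiable, `hypothesisBlock_satisfiable`, and the conclusion is `G`-free). -/
theorem modelBlind_iff_latticeSaturation :
    (∀ (G : LatticeCorrFamily 3) (ρ : ℝ → ℝ) (Δ : ℝ) (S : CorrFamily 3), (∀ δ ∈ Set.Ioc (0:ℝ) 1, 0 < ρ δ) →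
        0 < Δ → HasPointwiseScalingLimit G ρ S → IsNondegenerateTwoPoint S → IsMoebiusCovariant Δ S →
        ¬ HasNontrivialU4 S →
        ∀ ε : ℝ, 0 < ε → ∃ p₀ : ℝ, 0 < p₀ ∧ ∀ p : ℝ, 0 < p → p < p₀ → ∃ L₀ : ℕ, ∀ L ≥ L₀,
          1 - ε ≤ plantedEff L ⌈p * ((box 3 L).card : ℝ)⌉₊) ↔
      ∀ ε : ℝ, 0 < ε → ∃ p₀ : ℝ, 0 < p₀ ∧ ∀ p : ℝ, 0 < p → p < p₀ → ∃ L₀ : ℕ, ∀ L ≥ L₀,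
        1 - ε ≤ plantedEff L ⌈p * ((box 3 L).card : ℝ)⌉₊ := by
  constructor
  · intro h
    obtain ⟨G, ρ, Δ, S, hρ, hΔ, hlim, hnd, hmob, hU4⟩ := hypothesisBlock_satisfiable
    exact h G ρ Δ S hρ hΔ hlim hnd hmob hU4
  · intro h G ρ Δ S _ _ _ _ _ _
    exact h

/-- **The model-blind crux is refuted by r2.** Given `PinningEfficiencyDeficit`, the crux with `criticalCorr 3`
replaced by an arbitrary lattice family is FALSE: a proof of r3 compatible with the route must use the critical
Ising correlators beyond the hypothesis block (and, the conclusion being `S`-free, only to refute the block). -/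
theorem not_modelBlind_of_deficit (hdef : PinningEfficiencyDeficit) :
    ¬ ∀ (G : LatticeCorrFamily 3) (ρ : ℝ → ℝ) (Δ : ℝ) (S : CorrFamily 3), (∀ δ ∈ Set.Ioc (0:ℝ) 1, 0 < ρ δ) →
        0 < Δ → HasPointwiseScalingLimit G ρ S → IsNondegenerateTwoPoint S → IsMoebiusCovariant Δ S →
        ¬ HasNontrivialU4 S →
        ∀ ε : ℝ, 0 < ε → ∃ p₀ : ℝ, 0 < p₀ ∧ ∀ p : ℝ, 0 < p → p < p₀ → ∃ L₀ : ℕ, ∀ L ≥ L₀,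
          1 - ε ≤ plantedEff L ⌈p * ((box 3 L).card : ℝ)⌉₊ :=
  fun h => not_latticeSaturation_of_deficit hdef (modelBlind_iff_latticeSaturation.1 h)

/-- **The model-blind crux implies the crux** (specialise `G := criticalCorr 3`); with
`modelBlind_iff_latticeSaturation` this says: unconditional lattice saturation proves r3 — the only way to prove
r3 without refuting its hypothesis block, and the way r2 forbids. -/
theorem gaussianPinningSaturation_of_latticeSaturation
    (h : ∀ ε : ℝ, 0 < ε → ∃ p₀ : ℝ, 0 < p₀ ∧ ∀ p : ℝ, 0 < p → p < p₀ → ∃ L₀ : ℕ, ∀ L ≥ L₀,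
        1 - ε ≤ plantedEff L ⌈p * ((box 3 L).card : ℝ)⌉₊) :
    GaussianPinningSaturation := by
  rw [gaussianPinningSaturation_iff]
  intro _ _ _ _ _ _ _ _ _
  exact h

/-! ### Appended (lead seat c2, wave 1): the blocker is exactly item 0636

The wave-1 stub-worker on stub C located the landed normalisation lemma
`PerfectScreeningGaussianLimitIsCoulomb.exists_moebius_normalisation_of_gaussian` (every Gaussian non-degenerate
pointwise limit of `criticalCorr 3` agrees off coincidences with a Möbius-covariant one, `Δ' ∈ [1/2, 3/4]`), which
upgrades `gaussianPinningSaturation_iff_moebiusNonGaussian` to an equivalence with item 0636 VERBATIM. -/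

/-- **Möbius-restricted non-Gaussianity ⟺ item 0636.** "Every non-degenerate Möbius-covariant (`Δ > 0`) pointwise
limit of `criticalCorr 3` has `U₄ ≢ 0`" is equivalent to `IsingEuclidUpgradeR4NonGaussian` (no covariance
hypothesis): a Gaussian non-degenerate limit renormalises on coincident configurations to a Möbius-covariant one with
`Δ' ∈ [1/2, 3/4]` and the same `U₄` off coincidences (`exists_moebius_normalisation_of_gaussian`). (Proof found by the
wave-1 stub-worker of this line.) -/
theorem moebiusNonGaussian_iff_R4NonGaussian :
    (∀ (ρ : ℝ → ℝ) (Δ : ℝ) (S : CorrFamily 3), (∀ δ ∈ Set.Ioc (0:ℝ) 1, 0 < ρ δ) → 0 < Δ →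
      HasPointwiseScalingLimit (criticalCorr 3) ρ S → IsNondegenerateTwoPoint S →
      IsMoebiusCovariant Δ S → HasNontrivialU4 S) ↔ IsingEuclidUpgradeR4NonGaussian := by
  constructor
  · intro h ρ S hρ hlim hnd
    by_contra hU4
    have hU : ∀ z ∈ NonCoincident 3 4, limitConnectedFour S z = 0 := by
      intro z hz
      by_contra hne
      exact hU4 ⟨z, hz, hne⟩
    obtain ⟨Δ', N, hΔ', hlimN, hndN, hmobN, hU4N, -⟩ :=
      PerfectScreeningGaussianLimitIsCoulomb.exists_moebius_normalisation_of_gaussian hρ hlim hnd hU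
    exact hU4N (h ρ Δ' N hρ (by linarith [hΔ'.1]) hlimN hndN hmobN)
  · intro h ρ _ S hρ _ hlim hnd _
    exact h ρ S hρ hlim hnd

/-- **Under r2, the crux r3 ⟺ item 0636 verbatim.** Given `PinningEfficiencyDeficit`,
`GaussianPinningSaturation ↔ IsingEuclidUpgradeR4NonGaussian`: within the route, r3 carries exactly the
non-Gaussianity of the 3D Ising scaling limit (clause (iii)), and its vacuous payer
`gaussianPinningSaturation_of_R4NonGaussian` is also necessary. -/
theorem gaussianPinningSaturation_iff_R4NonGaussian (hdef : PinningEfficiencyDeficit) :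
    GaussianPinningSaturation ↔ IsingEuclidUpgradeR4NonGaussian :=
  (gaussianPinningSaturation_iff_moebiusNonGaussian hdef).trans moebiusNonGaussian_iff_R4NonGaussian

/-- Registered bookkeeping stub `stub_cruxIffR4NonGaussian` of the crux item (lead seat c2): under r2 the crux is
equivalent to item 0636, keyed by its registered name (= `gaussianPinningSaturation_iff_R4NonGaussian`). -/
theorem stub_cruxIffR4NonGaussian : PinningEfficiencyDeficit → (GaussianPinningSaturation ↔ IsingEuclidUpgradeR4NonGaussian) :=
  gaussianPinningSaturation_iff_R4NonGaussian

/-! ### Appended (lead seat c2): the unconditional position of the crux — `r3 ⟺ (0636 ∨ lattice saturation)` -/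

/-- **The hypothesis block of r3 is inconsistent iff item 0636 holds.** "There is no non-degenerate Möbius-covariant
(`Δ > 0`) pointwise scaling limit of `criticalCorr 3` with `U₄ ≡ 0` off coincidences" is equivalent to
`IsingEuclidUpgradeR4NonGaussian`. -/
theorem not_hypothesisBlock_iff_R4NonGaussian :
    (¬ ∃ (ρ : ℝ → ℝ) (Δ : ℝ) (S : CorrFamily 3), (∀ δ ∈ Set.Ioc (0:ℝ) 1, 0 < ρ δ) ∧ 0 < Δ ∧
        HasPointwiseScalingLimit (criticalCorr 3) ρ S ∧ IsNondegenerateTwoPoint S ∧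
        IsMoebiusCovariant Δ S ∧ ¬ HasNontrivialU4 S) ↔ IsingEuclidUpgradeR4NonGaussian := by
  rw [← moebiusNonGaussian_iff_R4NonGaussian]
  constructor
  · intro h ρ Δ S hρ hΔ hlim hnd hmob
    by_contra hU4
    exact h ⟨ρ, Δ, S, hρ, hΔ, hlim, hnd, hmob, hU4⟩
  · rintro h ⟨ρ, Δ, S, hρ, hΔ, hlim, hnd, hmob, hU4⟩
    exact hU4 (h ρ Δ S hρ hΔ hlim hnd hmob)

/-- **Unconditional position of the crux: `GaussianPinningSaturation ↔ (0636 ∨ unconditional lattice saturation)`.**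
No route hypothesis is used: r3 holds iff either every non-degenerate pointwise scaling limit of the critical Ising
correlators on `ℤ³` is non-Gaussian (item 0636, clause (iii) of the conjunct) or the planted-pinning efficiency of
the critical `+` boxes saturates unconditionally (`e_L(⌈pn⌉) → 1`, which the route's r2 denies). -/
theorem gaussianPinningSaturation_iff_R4NonGaussian_or_latticeSaturation :
    GaussianPinningSaturation ↔
      (IsingEuclidUpgradeR4NonGaussian ∨
        ∀ ε : ℝ, 0 < ε → ∃ p₀ : ℝ, 0 < p₀ ∧ ∀ p : ℝ, 0 < p → p < p₀ → ∃ L₀ : ℕ, ∀ L ≥ L₀,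
          1 - ε ≤ plantedEff L ⌈p * ((box 3 L).card : ℝ)⌉₊) := by
  rw [gaussianPinningSaturation_iff_imp, ← not_hypothesisBlock_iff_R4NonGaussian]
  constructor
  · intro h
    by_cases hb : ∃ (ρ : ℝ → ℝ) (Δ : ℝ) (S : CorrFamily 3), (∀ δ ∈ Set.Ioc (0:ℝ) 1, 0 < ρ δ) ∧ 0 < Δ ∧
        HasPointwiseScalingLimit (criticalCorr 3) ρ S ∧ IsNondegenerateTwoPoint S ∧
        IsMoebiusCovariant Δ S ∧ ¬ HasNontrivialU4 S
    · exact Or.inr (h hb)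
    · exact Or.inl hb
  · rintro (h | h) hb
    · exact absurd hb h
    · exact h

/-- Registered bookkeeping stub `stub_cruxIffR4NonGaussianOrSaturation` of the crux item (lead seat c2): the
unconditional position of the crux, keyed by its registered name
(= `gaussianPinningSaturation_iff_R4NonGaussian_or_latticeSaturation`). -/
theorem stub_cruxIffR4NonGaussianOrSaturation : GaussianPinningSaturation ↔ (IsingEuclidUpgradeR4NonGaussian ∨ ∀ ε : ℝ, 0 < ε → ∃ p₀ : ℝ, 0 < p₀ ∧ ∀ p : ℝ, 0 < p → p < p₀ → ∃ L₀ : ℕ, ∀ L ≥ L₀, 1 - ε ≤ plantedEff L ⌈p * ((box 3 L).card : ℝ)⌉₊) :=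
  gaussianPinningSaturation_iff_R4NonGaussian_or_latticeSaturation

end Summit.CriticalPhenomena.Ising3DConformalLimit.PlantedPinningGaussianPinningSaturation

end
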